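import Summits.NavierStokesRegularity.NavierStokesRegularity.Theorems.ExtremiserTransienceTwoThirdsDefs
import Summits.NavierStokesRegularity.NavierStokesRegularity.Theorems.ExtremiserTransienceLocalMaximiserVariations
import HarnessLib

/-!
# Route `ExtremiserTransience`, crux `NearExtremalTransiencePerFlow` (stmt-NavierStokesRegularity-26567), LINE g10-1 «two_thirds»
# (ns-idea-10 g10), stub S2 `FirstOrderIdentity`: additivity of the first variation and the LAYER COMPARISON of the bulks

Helper file for S2 (`--supports stmt-NavierStokesRegularity-26567`).  In the proof of S2 the Euler–Lagrange identity is
evaluated on `curl(χψ) = −φ₀ − χ∇q` and split by linearity of `a₁`; the layer formula `a1_layer` then expresses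
`3J_{χ²} − 2K_{χ²}` (weighted bulks `Jg`, `Kg`) while S2 speaks of the sharp ball bulks `J_B, Z_B, W_B` (`Jb Zb Wb`).  This
file supplies the two bookkeeping pieces:

* `c1_add`, `z1_add`, `w1_add`, `a1_add` — the first variation `a₁(φ)` of the local gain is ADDITIVE in the direction `φ`;
* `abs_sd_le` — `|⟪ω, DV ω⟫| ≤ ‖DV‖·|ω|²`;
* `abs_Jg_sub_Jb_le`, `abs_two_Kg_sub_le` — for a weight `0 ≤ χ ≤ 1` equal to `1` on `B(c,R)` and to `0` off `B(c,R+ℓ)` and a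
  field with `‖DV‖ ≤ A₁`: `|J_{χ²} − J_B| ≤ A₁·(Z_{B(c,R+ℓ)} − Z_B)` and
  `|2K_{χ²} − κ⋆(Z_B + W_B)| ≤ κ⋆·((Z+W)_{B(c,R+ℓ)} − (Z+W)_B)` — the weighted bulks differ from the ball bulks by the LAYER bulk,
  which the light-layer clause of S2 bounds by `η·bulk`;
* `abs_three_Jb_sub_le` — the resulting triangle inequality
  `|3J_B − κ⋆(Z_B+W_B)| ≤ |3J_{χ²} − 2K_{χ²}| + 3A₁·layerZ + κ⋆·layer bulk`.

HONEST FRAMING: calculus/measure bookkeeping; nothing about Navier–Stokes regularity or blow-up is proved; S2, the crux ⟨26567⟩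
and NS regularity are OPEN; no summit is proved by a line. [folklore]
-/

noncomputable section

open scoped Topology InnerProductSpace RealInnerProductSpace ENNReal ContDiff
open MeasureTheory Filter Set Metric
open Literature.Analysis.FluidPDE
open Summit.NavierStokesRegularity.NavierStokesRegularity.Theorems.DepletionLadder.KStar.HalfSpace
open Summit.NavierStokesRegularity.NavierStokesRegularity.Theorems.DepletionLadder
open Summit.NavierStokesRegularity.NavierStokesRegularity.Theorems.NearExtremalTransiencePerFlow.LocalMaximiser

namespace Summit.NavierStokesRegularity.NavierStokesRegularity.Theorems.NearExtremalTransiencePerFlow.TwoThirds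

-- the summit's namespace repeats the problem name by convention (D-0017)
set_option linter.dupNamespace false

variable {V φ φ' : E3 → E3}

/-! ## Additivity of the first variation -/

/-- `c₁` is additive in the direction. [folklore] -/
theorem c1_add (hφ : ContDiff ℝ (⊤ : ℕ∞) φ) (hφ' : ContDiff ℝ (⊤ : ℕ∞) φ') (x : E3) :
    c1 V (φ + φ') x = c1 V φ x + c1 V φ' x := by
  have hφd : Differentiable ℝ φ := hφ.differentiable (by simp)
  have hφ'd : Differentiable ℝ φ' := hφ'.differentiable (by simp)
  have e1 : curl (φ + φ') x = curl φ x + curl φ' x := curl_add (hφd x) (hφ'd x)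
  have e2 : fderiv ℝ (φ + φ') x = fderiv ℝ φ x + fderiv ℝ φ' x := fderiv_add (hφd x) (hφ'd x)
  unfold c1
  rw [e1, e2]
  simp only [inner_add_left, inner_add_right, map_add, FunLike.coe_add, Pi.add_apply]
  ring

/-- `z₁` is additive in the direction. [folklore] -/
theorem z1_add (hφ : ContDiff ℝ (⊤ : ℕ∞) φ) (hφ' : ContDiff ℝ (⊤ : ℕ∞) φ') (x : E3) :
    z1 V (φ + φ') x = z1 V φ x + z1 V φ' x := by
  have hφd : Differentiable ℝ φ := hφ.differentiable (by simp)
  have hφ'd : Differentiable ℝ φ' := hφ'.differentiable (by simp)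
  have e1 : curl (φ + φ') x = curl φ x + curl φ' x := curl_add (hφd x) (hφ'd x)
  unfold z1
  rw [e1, inner_add_right]

/-- `w₁` is additive in the direction. [folklore] -/
theorem w1_add (hφ : ContDiff ℝ (⊤ : ℕ∞) φ) (hφ' : ContDiff ℝ (⊤ : ℕ∞) φ') (x : E3) :
    w1 V (φ + φ') x = w1 V φ x + w1 V φ' x := by
  have hφd : Differentiable ℝ φ := hφ.differentiable (by simp)
  have hφ'd : Differentiable ℝ φ' := hφ'.differentiable (by simp)
  have h1 : ContDiff ℝ 1 (curl φ) := contDiff_curl (n := 1) (hφ.of_le (by norm_cast))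
  have h2 : ContDiff ℝ 1 (curl φ') := contDiff_curl (n := 1) (hφ'.of_le (by norm_cast))
  have hc : curl (φ + φ') = fun y => curl φ y + curl φ' y := funext fun y => curl_add (hφd y) (hφ'd y)
  have e : fderiv ℝ (curl (φ + φ')) x = fderiv ℝ (curl φ) x + fderiv ℝ (curl φ') x := by
    rw [hc]
    exact fderiv_fun_add ((h1.differentiable one_ne_zero) x) ((h2.differentiable one_ne_zero) x)
  unfold w1
  rw [e, ← Finset.sum_add_distrib]
  refine Finset.sum_congr rfl fun i _ => ?_
  rw [FunLike.coe_add, Pi.add_apply, inner_add_right]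

/-- **The first variation is additive in the direction**: `a₁(φ + φ') = a₁(φ) + a₁(φ')` for smooth compactly supported
`φ, φ'` at a smooth field `V`. [folklore] -/
theorem a1_add {κ μ : ℝ} (hV : ContDiff ℝ (⊤ : ℕ∞) V) (hφ : ContDiff ℝ (⊤ : ℕ∞) φ) (hφc : HasCompactSupport φ)
    (hφ' : ContDiff ℝ (⊤ : ℕ∞) φ') (hφ'c : HasCompactSupport φ') :
    a1 κ μ V (φ + φ') = a1 κ μ V φ + a1 κ μ V φ' := by
  -- integrability of the `a₁`-integrand for a smooth compactly supported direction
  have hint : ∀ ψ : E3 → E3, ContDiff ℝ (⊤ : ℕ∞) ψ → HasCompactSupport ψ →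
      Integrable fun x => c1 V ψ x - (κ / 2) * (μ⁻¹ * (2 * z1 V ψ x) + μ * (2 * w1 V ψ x)) := by
    intro ψ hψ hψc
    have ic : Integrable (c1 V ψ) := (KStar.integrable_stretching_coeffs hV hψ hψc).1
    have iz : Integrable (z1 V ψ) := (KStar.integrable_enstrophy_coeffs hV hψ hψc).1
    have iw : Integrable (w1 V ψ) := (KStar.integrable_palinstrophy_coeffs hV hψ hψc).1
    exact ic.sub ((((iz.const_mul 2).const_mul μ⁻¹).add ((iw.const_mul 2).const_mul μ)).const_mul (κ / 2))
  unfold a1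
  rw [← integral_add (hint φ hφ hφc) (hint φ' hφ' hφ'c)]
  refine integral_congr_ae (Eventually.of_forall fun x => ?_)
  simp only [c1_add hφ hφ' x, z1_add hφ hφ' x, w1_add hφ hφ' x]
  ring

/-! ## The layer comparison of the bulks -/

/-- `|⟪ω, DV ω⟫| ≤ ‖DV‖·|ω|²`. [folklore] -/
theorem abs_sd_le (V : E3 → E3) (x : E3) : |sd V x| ≤ ‖fderiv ℝ V x‖ * zd V x := by
  unfold sd zd
  calc |⟪curl V x, fderiv ℝ V x (curl V x)⟫| ≤ ‖curl V x‖ * ‖fderiv ℝ V x (curl V x)‖ := abs_real_inner_le_norm _ _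
    _ ≤ ‖curl V x‖ * (‖fderiv ℝ V x‖ * ‖curl V x‖) :=
        mul_le_mul_of_nonneg_left (ContinuousLinearMap.le_opNorm _ _) (norm_nonneg _)
    _ = ‖fderiv ℝ V x‖ * ‖curl V x‖ ^ 2 := by ring

/-- Continuous densities are integrable on balls. -/
theorem integrableOn_ball_of_continuous {f : E3 → ℝ} (hf : Continuous f) (c : E3) (r : ℝ) :
    IntegrableOn f (ball c r) :=
  (hf.continuousOn.integrableOn_compact (isCompact_closedBall c r)).mono_set ball_subset_closedBall

/-- The layer integral of a nonnegative continuous density as a difference of ball bulks: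
`∫_{B(c,R+ℓ)} 1_{B(c,R)ᶜ} f = ∫_{B(c,R+ℓ)} f − ∫_{B(c,R)} f`. [folklore] -/
theorem setIntegral_indicator_compl_ball {f : E3 → ℝ} (hf : Continuous f) (c : E3) {R ℓ : ℝ} (hℓ : 0 ≤ ℓ) :
    ∫ x in ball c (R + ℓ), (ball c R)ᶜ.indicator f x = (∫ x in ball c (R + ℓ), f x) - ∫ x in ball c R, f x := by
  have hsub : ball c R ⊆ ball c (R + ℓ) := ball_subset_ball (by linarith)
  rw [← setIntegral_sdiff measurableSet_ball (integrableOn_ball_of_continuous hf c (R + ℓ)) hsub,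
    setIntegral_indicator measurableSet_ball.compl]
  congr 1

/-- Core layer estimate: if `D` vanishes on `B(c,R)` and `|D| ≤ A·f` off it (`f ≥ 0` continuous), then
`|∫_{B(c,R+ℓ)} D| ≤ A·(∫_{B(c,R+ℓ)} f − ∫_{B(c,R)} f)`. [folklore] -/
theorem abs_setIntegral_le_layer {D f : E3 → ℝ} (hf : Continuous f) {A : ℝ} {c : E3} {R ℓ : ℝ}
    (hℓ : 0 ≤ ℓ) (hin : ∀ x ∈ ball c R, D x = 0) (hout : ∀ x, x ∉ ball c R → |D x| ≤ A * f x) :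
    |∫ x in ball c (R + ℓ), D x| ≤ A * ((∫ x in ball c (R + ℓ), f x) - ∫ x in ball c R, f x) := by
  rw [← setIntegral_indicator_compl_ball hf c hℓ, ← integral_const_mul, ← Real.norm_eq_abs]
  have hint : IntegrableOn (fun x => A * (ball c R)ᶜ.indicator f x) (ball c (R + ℓ)) :=
    (((integrableOn_ball_of_continuous hf c (R + ℓ)).indicator measurableSet_ball.compl).const_mul A)
  refine norm_integral_le_of_norm_le hint (Eventually.of_forall fun x => ?_)
  rw [Real.norm_eq_abs]
  by_cases hx : x ∈ ball c R
  · have h0 : (ball c R)ᶜ.indicator f x = 0 := indicator_of_notMem (Set.notMem_compl_iff.2 hx) _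
    rw [hin x hx, h0, abs_zero, mul_zero]
  · rw [indicator_of_mem (mem_compl hx)]
    exact hout x hx

/-- **Weighted vs sharp stretching bulk**: for a continuous weight `χ` with `0 ≤ χ ≤ 1`, `χ = 1` on `B(c,R)`, `χ = 0` off
`B(c,R+ℓ)`, and `‖DV‖ ≤ A₁`: `|J_{χ²} − J_B| ≤ A₁·(Z_{B(c,R+ℓ)} − Z_{B(c,R)})`. [folklore] -/
theorem abs_Jg_sub_Jb_le (hV : ContDiff ℝ (⊤ : ℕ∞) V) {A₁ : ℝ} (hA : ∀ x, ‖fderiv ℝ V x‖ ≤ A₁) {χ : E3 → ℝ}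
    (hχ : Continuous χ) (hχ01 : ∀ x, 0 ≤ χ x ∧ χ x ≤ 1) {c : E3} {R ℓ : ℝ} (hℓ : 0 ≤ ℓ)
    (hχ1 : ∀ x ∈ ball c R, χ x = 1) (hχ0 : ∀ x, x ∉ ball c (R + ℓ) → χ x = 0) :
    |Jg χ V - Jb V c R| ≤ A₁ * (Zb V c (R + ℓ) - Zb V c R) := by
  have csd : Continuous (sd V) := continuous_sd' hV
  have czd : Continuous (zd V) := continuous_zd' hV
  have hsub : ball c R ⊆ ball c (R + ℓ) := ball_subset_ball (by linarith)
  have hJg : Jg χ V = ∫ x in ball c (R + ℓ), χ x ^ 2 * sd V x := by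
    unfold Jg
    rw [← integral_indicator measurableSet_ball]
    refine integral_congr_ae (Eventually.of_forall fun x => ?_)
    show χ x ^ 2 * sd V x = (ball c (R + ℓ)).indicator (fun x => χ x ^ 2 * sd V x) x
    by_cases hx : x ∈ ball c (R + ℓ)
    · rw [indicator_of_mem hx]
    · rw [indicator_of_notMem hx, hχ0 x hx]; ring
  have hJb : Jb V c R = ∫ x in ball c (R + ℓ), (ball c R).indicator (sd V) x := by
    unfold Jb
    rw [setIntegral_indicator measurableSet_ball, inter_eq_self_of_subset_right hsub]
  have i1 : IntegrableOn (fun x => χ x ^ 2 * sd V x) (ball c (R + ℓ)) :=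
    integrableOn_ball_of_continuous ((hχ.pow 2).mul csd) c (R + ℓ)
  have i2 : IntegrableOn ((ball c R).indicator (sd V)) (ball c (R + ℓ)) :=
    (integrableOn_ball_of_continuous csd c (R + ℓ)).indicator measurableSet_ball
  rw [hJg, hJb, ← integral_sub i1 i2]
  unfold Zb
  refine abs_setIntegral_le_layer czd hℓ (fun x hx => ?_) (fun x hx => ?_)
  · rw [indicator_of_mem hx, hχ1 x hx]; ring
  · rw [indicator_of_notMem hx, sub_zero, abs_mul, abs_of_nonneg (sq_nonneg _)]
    have h2 : χ x ^ 2 ≤ 1 := by nlinarith [(hχ01 x).1, (hχ01 x).2]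
    have h3 : |sd V x| ≤ A₁ * zd V x :=
      (abs_sd_le V x).trans (mul_le_mul_of_nonneg_right (hA x) (by unfold zd; positivity))
    have h4 : 0 ≤ A₁ * zd V x := (abs_nonneg _).trans h3
    nlinarith [abs_nonneg (sd V x)]

/-- **Weighted vs sharp quadratic bulk**: same weight, `|2K_{χ²} − κ⋆(Z_B + W_B)| ≤ κ⋆·((Z+W)_{B(c,R+ℓ)} − (Z+W)_{B(c,R)})`.
[folklore] -/
theorem abs_two_Kg_sub_le (hV : ContDiff ℝ (⊤ : ℕ∞) V) {χ : E3 → ℝ}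
    (hχ : Continuous χ) (hχ01 : ∀ x, 0 ≤ χ x ∧ χ x ≤ 1) {c : E3} {R ℓ : ℝ} (hℓ : 0 ≤ ℓ)
    (hχ1 : ∀ x ∈ ball c R, χ x = 1) (hχ0 : ∀ x, x ∉ ball c (R + ℓ) → χ x = 0) :
    |2 * Kg χ V - kStar * (Zb V c R + Wb V c R)| ≤
      kStar * ((Zb V c (R + ℓ) + Wb V c (R + ℓ)) - (Zb V c R + Wb V c R)) := by
  have czd : Continuous (zd V) := continuous_zd' hV
  have cwd : Continuous (wd V) := continuous_wd' hV
  have cb : Continuous fun x => zd V x + wd V x := czd.add cwd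
  have hsub : ball c R ⊆ ball c (R + ℓ) := ball_subset_ball (by linarith)
  have hK : 0 < kStar := kStar_pos
  have hnn : ∀ x, 0 ≤ zd V x + wd V x := fun x => add_nonneg (by unfold zd; positivity) (frobeniusNormSq_nonneg _)
  -- both sides as integrals over the big ball of the density `zd + wd`
  have hKg : 2 * Kg χ V = kStar * ∫ x in ball c (R + ℓ), χ x ^ 2 * (zd V x + wd V x) := by
    unfold Kg
    rw [← integral_indicator measurableSet_ball]
    have e : (fun x => χ x ^ 2 * (zd V x + wd V x)) = (ball c (R + ℓ)).indicator fun x => χ x ^ 2 * (zd V x + wd V x) := by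
      funext x
      by_cases hx : x ∈ ball c (R + ℓ)
      · rw [indicator_of_mem hx]
      · rw [indicator_of_notMem hx, hχ0 x hx]; ring
    rw [← e]
    ring
  have hZW : ∀ r, Zb V c r + Wb V c r = ∫ x in ball c r, (zd V x + wd V x) := fun r => by
    unfold Zb Wb
    rw [integral_add (integrableOn_ball_of_continuous czd c r) (integrableOn_ball_of_continuous cwd c r)]
  have hB : Zb V c R + Wb V c R = ∫ x in ball c (R + ℓ), (ball c R).indicator (fun x => zd V x + wd V x) x := by
    rw [hZW, setIntegral_indicator measurableSet_ball, inter_eq_self_of_subset_right hsub]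
  have i1 : IntegrableOn (fun x => χ x ^ 2 * (zd V x + wd V x)) (ball c (R + ℓ)) :=
    integrableOn_ball_of_continuous ((hχ.pow 2).mul cb) c (R + ℓ)
  have i2 : IntegrableOn ((ball c R).indicator fun x => zd V x + wd V x) (ball c (R + ℓ)) :=
    (integrableOn_ball_of_continuous cb c (R + ℓ)).indicator measurableSet_ball
  have eL : kStar * (∫ x in ball c (R + ℓ), χ x ^ 2 * (zd V x + wd V x)) - kStar * (Zb V c R + Wb V c R) =
      kStar * ∫ x in ball c (R + ℓ), (χ x ^ 2 * (zd V x + wd V x) - (ball c R).indicator (fun x => zd V x + wd V x) x) := by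
    rw [hB, integral_sub i1 i2, mul_sub]
  have eR : (Zb V c (R + ℓ) + Wb V c (R + ℓ)) - (Zb V c R + Wb V c R) =
      (∫ x in ball c (R + ℓ), (zd V x + wd V x)) - ∫ x in ball c R, (zd V x + wd V x) := by
    rw [hZW, hZW]
  rw [hKg, eL, eR, abs_mul, abs_of_pos hK]
  refine mul_le_mul_of_nonneg_left ?_ hK.le
  have h := abs_setIntegral_le_layer (A := 1) cb hℓ (D := fun x => χ x ^ 2 * (zd V x + wd V x) -
    (ball c R).indicator (fun x => zd V x + wd V x) x) (c := c) (R := R) (fun x hx => ?_) (fun x hx => ?_)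
  · simpa using h
  · simp only [indicator_of_mem hx, hχ1 x hx]; ring
  · rw [indicator_of_notMem hx, sub_zero, abs_mul, abs_of_nonneg (sq_nonneg _), abs_of_nonneg (hnn x), one_mul]
    have h2 : χ x ^ 2 ≤ 1 := by nlinarith [(hχ01 x).1, (hχ01 x).2]
    nlinarith [hnn x]

/-- **The triangle inequality of S2's endgame**: with the weighted bulks controlled by the layer formula and the layer bulks by
the light-layer clause, `|3J_B − κ⋆(Z_B + W_B)| ≤ |3J_{χ²} − 2K_{χ²}| + 3A₁·layerZ + κ⋆·layer bulk`. [folklore] -/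
theorem abs_three_Jb_sub_le (hV : ContDiff ℝ (⊤ : ℕ∞) V) {A₁ : ℝ} (hA : ∀ x, ‖fderiv ℝ V x‖ ≤ A₁) {χ : E3 → ℝ}
    (hχ : Continuous χ) (hχ01 : ∀ x, 0 ≤ χ x ∧ χ x ≤ 1) {c : E3} {R ℓ : ℝ} (hℓ : 0 ≤ ℓ)
    (hχ1 : ∀ x ∈ ball c R, χ x = 1) (hχ0 : ∀ x, x ∉ ball c (R + ℓ) → χ x = 0) :
    |3 * Jb V c R - kStar * (Zb V c R + Wb V c R)| ≤
      |3 * Jg χ V - 2 * Kg χ V| + 3 * (A₁ * (Zb V c (R + ℓ) - Zb V c R)) +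
        kStar * ((Zb V c (R + ℓ) + Wb V c (R + ℓ)) - (Zb V c R + Wb V c R)) := by
  have h1 := abs_Jg_sub_Jb_le hV hA hχ hχ01 hℓ hχ1 hχ0
  have h2 := abs_two_Kg_sub_le hV hχ hχ01 hℓ hχ1 hχ0
  have e : 3 * Jb V c R - kStar * (Zb V c R + Wb V c R) =
      (3 * Jg χ V - 2 * Kg χ V) - 3 * (Jg χ V - Jb V c R) + (2 * Kg χ V - kStar * (Zb V c R + Wb V c R)) := by ring
  rw [e]
  calc |(3 * Jg χ V - 2 * Kg χ V) - 3 * (Jg χ V - Jb V c R) + (2 * Kg χ V - kStar * (Zb V c R + Wb V c R))|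
      ≤ |(3 * Jg χ V - 2 * Kg χ V) - 3 * (Jg χ V - Jb V c R)| + |2 * Kg χ V - kStar * (Zb V c R + Wb V c R)| :=
        abs_add_le _ _
    _ ≤ |3 * Jg χ V - 2 * Kg χ V| + |3 * (Jg χ V - Jb V c R)| + |2 * Kg χ V - kStar * (Zb V c R + Wb V c R)| := by
        gcongr
        exact abs_sub _ _
    _ ≤ _ := by
        rw [abs_mul, abs_of_pos (by norm_num : (0 : ℝ) < 3)]
        gcongr

end Summit.NavierStokesRegularity.NavierStokesRegularity.Theorems.NearExtremalTransiencePerFlow.TwoThirds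

end
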